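import Summits.CriticalPhenomena.PercolationContinuityZ3.Theorems.Transplant.FKConnectivityAllQAntipodalDeletionCells
import Summits.CriticalPhenomena.PercolationContinuityZ3.Theorems.Transplant.FKConnectivityAllQAntipodalLevel3All
import HarnessLib

/-!
# Connectivity correlation inequalities for `φ_{w,q}`, every `q > 0` — file 40: **LEVEL ≤ 3, `maj₃` AND THE FOUR-EDGE THRESHOLDS IN
# EVERY DELETION CELL** (every square-free coefficient)

Support file (`--supports stmt-CriticalPhenomena-4575`), FK sub-lane `prim-bschramm-fk-2` (gen 20); builds on p205010 (kernel theorem,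
internal audit signed; external expert review pending).  No definitions, no named facts, no sorries; standard axioms.

With Theorem U, AND and U¹¹ available on every live sub-host `M ⊆ E ∪ {st}` (file 39), the algebra of files 34/35 runs unchanged:
* **`FK.apPsi_level3_sub_nonpos_of_isTTSP`** — `apPsi q M f g ≤ 0` for EVERY increasing `f` of three edges `x, y, z ∈ M` and every
  increasing `g` on `M` off them (+ `…'`, roles exchanged): gen 10's Conjecture `C_∞` for `min(|supp f|,|supp g|) ≤ 3` in every SQUARE-FREE
  coefficient of `Z_H² Cov_{φ_{z,q}}(f,g)`, `H` any 2-connected series–parallel graph, `0 < q ≤ 1`;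
* `FK.apPsi_maj3_sub_nonpos_of_isTTSP` (the majority of three edges, as an instance);
* **`FK.apPsi_thr3of4_sub_nonpos_of_isTTSP`**, `FK.apPsi_thr2of4_sub_nonpos_of_isTTSP` — the threshold events on four edges of `M`.
What is NOT here: the coefficients with a contracted set (`z_e²` monomials) — they need U¹¹ with a contracted set (memo
`bschramm/FROM-fk-2-g20-LEVEL3-ONESUM.md` §2.6: planar duality on paper).
[cite: Grimmett2006, §1.4 eq. (1.20) (p. 15); §3.8 Thm. (3.90) (pp. 61–62); §3.9 (pp. 63–64)] [cite: Wagner2006, Thm. 5.8(d), §5.3]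
-/

noncomputable section

namespace Summit.CriticalPhenomena.PercolationContinuityZ3.Theorems

namespace FK

open Literature.Probability.LatticeModels Literature.Probability.Percolation
open scoped Classical

variable {V : Type*} [Fintype V] {s t : V}

/-- **`C_∞` AT LEVEL ≤ 3 FOR EVERY INCREASING `f`, IN EVERY DELETION CELL** (`0 < q ≤ 1`): `E` TTSP between `s, t`, `st ∉ E`,
`M ⊆ E ∪ {st}` ANY live sub-host, `x, y, z ∈ M` distinct, `f` increasing on the subsets of `{x,y,z}` reading no other edge, `g` increasing on
the subsets of `M` reading none of `x, y, z` ⟹ `apPsi q M f g ≤ 0` — every SQUARE-FREE coefficient `[z^{1_M}] Z_H² Cov_{φ_{z,q}}(f,g)` is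
`≤ 0` (file 35's proof verbatim, fed with the deletion-cell inputs of file 39: `FK.apPsi_andSet_sub_nonpos_of_isTTSP`,
`FK.apPsi_pivot_sub_nonpos_of_isTTSP`, `FK.apPsi_pivot_split_sub_nonpos_of_isTTSP`).
[cite: Grimmett2006, §1.4 eq. (1.20) (p. 15); §3.8 Thm. (3.90) (pp. 61–62); §3.9 (pp. 63–64)] [cite: Wagner2006, Thm. 5.8(d), §5.3] -/
theorem apPsi_level3_sub_nonpos_of_isTTSP {q : ℝ} (hq0 : 0 < q) (hq1 : q ≤ 1) {E : Finset (Sym2 V)} (hE : IsTTSP E s t)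
    (hst : s(s, t) ∉ E) {M : Finset (Sym2 V)} (hM : M ⊆ insert s(s, t) E) {x y z : Sym2 V} (hx : x ∈ M) (hy : y ∈ M) (hz : z ∈ M)
    (hxy : x ≠ y) (hxz : x ≠ z) (hyz : y ≠ z) {f g : Finset (Sym2 V) → ℝ}
    (hf : ∀ e : Sym2 V, e ∉ ({x, y, z} : Finset (Sym2 V)) → ∀ A : Finset (Sym2 V), f (insert e A) = f A)
    (hfmono : ∀ ⦃A B : Finset (Sym2 V)⦄, A ⊆ B → B ⊆ ({x, y, z} : Finset (Sym2 V)) → f A ≤ f B)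
    (hgx : ∀ A : Finset (Sym2 V), g (insert x A) = g A) (hgy : ∀ A : Finset (Sym2 V), g (insert y A) = g A)
    (hgz : ∀ A : Finset (Sym2 V), g (insert z A) = g A)
    (hmono : ∀ ⦃A B : Finset (Sym2 V)⦄, A ⊆ B → B ⊆ M → g A ≤ g B) :
    apPsi q M f g ≤ 0 := by
  set H := M with hH
  -- the four AND functionals and their signs
  have hS3 : ({x, y, z} : Finset (Sym2 V)) ⊆ H := by simp [Finset.insert_subset_iff, hx, hy, hz]
  have hSxy : ({x, y} : Finset (Sym2 V)) ⊆ H := by simp [Finset.insert_subset_iff, hx, hy]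
  have hSxz : ({x, z} : Finset (Sym2 V)) ⊆ H := by simp [Finset.insert_subset_iff, hx, hz]
  have hSyz : ({y, z} : Finset (Sym2 V)) ⊆ H := by simp [Finset.insert_subset_iff, hy, hz]
  have ng3 : ∀ e ∈ ({x, y, z} : Finset (Sym2 V)), ∀ A : Finset (Sym2 V), g (insert e A) = g A := by
    intro e he A; simp only [Finset.mem_insert, Finset.mem_singleton] at he
    rcases he with rfl | rfl | rfl
    exacts [hgx A, hgy A, hgz A]
  have ngxy : ∀ e ∈ ({x, y} : Finset (Sym2 V)), ∀ A : Finset (Sym2 V), g (insert e A) = g A := fun e he A =>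
    ng3 e (by simp only [Finset.mem_insert, Finset.mem_singleton] at he ⊢; tauto) A
  have ngxz : ∀ e ∈ ({x, z} : Finset (Sym2 V)), ∀ A : Finset (Sym2 V), g (insert e A) = g A := fun e he A =>
    ng3 e (by simp only [Finset.mem_insert, Finset.mem_singleton] at he ⊢; tauto) A
  have ngyz : ∀ e ∈ ({y, z} : Finset (Sym2 V)), ∀ A : Finset (Sym2 V), g (insert e A) = g A := fun e he A =>
    ng3 e (by simp only [Finset.mem_insert, Finset.mem_singleton] at he ⊢; tauto) A
  have aS := apPsi_andSet_sub_nonpos_of_isTTSP hq0 hq1 hE hst hM hS3 ⟨x, by simp⟩ ng3 hmono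
  have axy := apPsi_andSet_sub_nonpos_of_isTTSP hq0 hq1 hE hst hM hSxy ⟨x, by simp⟩ ngxy hmono
  have axz := apPsi_andSet_sub_nonpos_of_isTTSP hq0 hq1 hE hst hM hSxz ⟨x, by simp⟩ ngxz hmono
  have ayz := apPsi_andSet_sub_nonpos_of_isTTSP hq0 hq1 hE hst hM hSyz ⟨y, by simp⟩ ngyz hmono
  -- Theorem U at x, y, z as relations among the AND functionals
  have ux := apPsi_pivot_sub_nonpos_of_isTTSP hq0 hq1 hE hst hM hx hgx hmono
  have uy := apPsi_pivot_sub_nonpos_of_isTTSP hq0 hq1 hE hst hM hy hgy hmono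
  have uz := apPsi_pivot_sub_nonpos_of_isTTSP hq0 hq1 hE hst hM hz hgz hmono
  rw [apPsi_pivot_eq_ands q hx hy hz hxy hxz] at ux
  rw [apPsi_pivot_eq_ands q hy hx hz hxy.symm hyz, Finset.pair_comm y x] at uy
  rw [apPsi_pivot_eq_ands q hz hx hy hxz.symm hyz.symm, Finset.pair_comm z x, Finset.pair_comm z y] at uz
  -- U¹¹ at x, y, z as relations among the AND functionals
  have vx := apPsi_pivot_split_sub_nonpos_of_isTTSP hq0 hq1 hE hst hM hx hy hz hxy hxz hyz hgx hgy hgz hmono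
  have vy := apPsi_pivot_split_sub_nonpos_of_isTTSP hq0 hq1 hE hst hM hy hx hz hxy.symm hyz hxz hgy hgx hgz hmono
  have vz := apPsi_pivot_split_sub_nonpos_of_isTTSP hq0 hq1 hE hst hM hz hx hy hxz.symm hyz.symm hxy hgz hgx hgy hmono
  rw [apPsi_pivot_split_eq_ands q hx hy hz hxy hxz hyz] at vx
  rw [apPsi_pivot_split_eq_ands q hy hx hz hxy.symm hyz hxz, Finset.pair_comm y x, Finset.insert_comm y x] at vy
  rw [apPsi_pivot_split_eq_ands q hz hx hy hxz.symm hyz.symm hxy, Finset.pair_comm z x, Finset.pair_comm z y,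
    Finset.insert_comm z x, Finset.pair_comm z y] at vz
  -- monotonicity of f on the subsets of {x, y, z}
  have sub : ∀ A : Finset (Sym2 V), (∀ e ∈ A, e = x ∨ e = y ∨ e = z) → A ⊆ ({x, y, z} : Finset (Sym2 V)) := fun A hA e he => by
    simp only [Finset.mem_insert, Finset.mem_singleton]; exact hA e he
  have m1 : f {x} ≤ f {x, y, z} := hfmono (by intro e; simp only [Finset.mem_insert, Finset.mem_singleton]; tauto) (sub _ (by simp))
  have m2 : f ∅ ≤ f {y, z} := hfmono (Finset.empty_subset _) (sub _ (by simp))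
  have m3 : f {y, z} ≤ f {x, y, z} := hfmono (by intro e; simp only [Finset.mem_insert, Finset.mem_singleton]; tauto) (sub _ (by simp))
  have m4 : f ∅ ≤ f {x} := hfmono (Finset.empty_subset _) (sub _ (by simp))
  have m5 : f {y} ≤ f {x, y, z} := hfmono (by intro e; simp only [Finset.mem_insert, Finset.mem_singleton]; tauto) (sub _ (by simp))
  have m6 : f ∅ ≤ f {x, z} := hfmono (Finset.empty_subset _) (sub _ (by simp))
  have m7 : f {x, z} ≤ f {x, y, z} := hfmono (by intro e; simp only [Finset.mem_insert, Finset.mem_singleton]; tauto) (sub _ (by simp))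
  have m8 : f ∅ ≤ f {y} := hfmono (Finset.empty_subset _) (sub _ (by simp))
  have m9 : f {z} ≤ f {x, y, z} := hfmono (by intro e; simp only [Finset.mem_insert, Finset.mem_singleton]; tauto) (sub _ (by simp))
  have m10 : f ∅ ≤ f {x, y} := hfmono (Finset.empty_subset _) (sub _ (by simp))
  have m11 : f {x, y} ≤ f {x, y, z} := hfmono (by intro e; simp only [Finset.mem_insert, Finset.mem_singleton]; tauto) (sub _ (by simp))
  have m12 : f ∅ ≤ f {z} := hfmono (Finset.empty_subset _) (sub _ (by simp))
  have n1 : f {x} ≤ f {x, y} := hfmono (by intro e; simp only [Finset.mem_insert, Finset.mem_singleton]; tauto) (sub _ (by simp))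
  have n2 : f {x} ≤ f {x, z} := hfmono (by intro e; simp only [Finset.mem_insert, Finset.mem_singleton]; tauto) (sub _ (by simp))
  have n3 : f {y} ≤ f {x, y} := hfmono (by intro e; simp only [Finset.mem_insert, Finset.mem_singleton]; tauto) (sub _ (by simp))
  have n4 : f {y} ≤ f {y, z} := hfmono (by intro e; simp only [Finset.mem_insert, Finset.mem_singleton]; tauto) (sub _ (by simp))
  have n5 : f {z} ≤ f {x, z} := hfmono (by intro e; simp only [Finset.mem_insert, Finset.mem_singleton]; tauto) (sub _ (by simp))
  have n6 : f {z} ≤ f {y, z} := hfmono (by intro e; simp only [Finset.mem_insert, Finset.mem_singleton]; tauto) (sub _ (by simp))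
  rw [apPsi_level3_eq q hx hy hz hf g]
  have key := level3_cone (P := - apPsi q H (fun A => if ({x, y, z} : Finset (Sym2 V)) ⊆ A then 1 else 0) g)
    (X := apPsi q H (fun A => if ({x, y, z} : Finset (Sym2 V)) ⊆ A then 1 else 0) g -
      apPsi q H (fun A => if ({y, z} : Finset (Sym2 V)) ⊆ A then 1 else 0) g)
    (Y := apPsi q H (fun A => if ({x, y, z} : Finset (Sym2 V)) ⊆ A then 1 else 0) g -
      apPsi q H (fun A => if ({x, z} : Finset (Sym2 V)) ⊆ A then 1 else 0) g)
    (Z := apPsi q H (fun A => if ({x, y, z} : Finset (Sym2 V)) ⊆ A then 1 else 0) g -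
      apPsi q H (fun A => if ({x, y} : Finset (Sym2 V)) ⊆ A then 1 else 0) g)
    (d0 := f {x, y, z} - f ∅) (dx := f {x} - f {y, z}) (dy := f {y} - f {x, z}) (dz := f {z} - f {x, y})
    (by linarith) (by linarith) (by linarith) (by linarith) (by linarith) (by linarith) (by linarith)
    (by linarith) (by linarith) (by linarith)
    (abs_le.2 ⟨by linarith, by linarith⟩) (abs_le.2 ⟨by linarith, by linarith⟩) (abs_le.2 ⟨by linarith, by linarith⟩)
    (by linarith) (by linarith) (by linarith)
  linarith


/-- **Level ≤ 3 in every deletion cell, roles exchanged** (`FK.apPsi_comm`). [cite: Grimmett2006, §3.8 Thm. (3.90) (pp. 61–62)] -/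
theorem apPsi_level3_sub_nonpos_of_isTTSP' {q : ℝ} (hq0 : 0 < q) (hq1 : q ≤ 1) {E : Finset (Sym2 V)} (hE : IsTTSP E s t)
    (hst : s(s, t) ∉ E) {M : Finset (Sym2 V)} (hM : M ⊆ insert s(s, t) E) {x y z : Sym2 V} (hx : x ∈ M) (hy : y ∈ M) (hz : z ∈ M)
    (hxy : x ≠ y) (hxz : x ≠ z) (hyz : y ≠ z) {f g : Finset (Sym2 V) → ℝ}
    (hfx : ∀ A : Finset (Sym2 V), f (insert x A) = f A) (hfy : ∀ A : Finset (Sym2 V), f (insert y A) = f A)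
    (hfz : ∀ A : Finset (Sym2 V), f (insert z A) = f A)
    (hfmono : ∀ ⦃A B : Finset (Sym2 V)⦄, A ⊆ B → B ⊆ M → f A ≤ f B)
    (hg : ∀ e : Sym2 V, e ∉ ({x, y, z} : Finset (Sym2 V)) → ∀ A : Finset (Sym2 V), g (insert e A) = g A)
    (hgmono : ∀ ⦃A B : Finset (Sym2 V)⦄, A ⊆ B → B ⊆ ({x, y, z} : Finset (Sym2 V)) → g A ≤ g B) :
    apPsi q M f g ≤ 0 := by
  rw [apPsi_comm]
  exact apPsi_level3_sub_nonpos_of_isTTSP hq0 hq1 hE hst hM hx hy hz hxy hxz hyz hg hgmono hfx hfy hfz hfmono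

/-- **The majority of three edges in every deletion cell** (instance of `FK.apPsi_level3_sub_nonpos_of_isTTSP`).
[cite: Grimmett2006, §3.8 Thm. (3.90) (pp. 61–62); §3.9 (pp. 63–64)] -/
theorem apPsi_maj3_sub_nonpos_of_isTTSP {q : ℝ} (hq0 : 0 < q) (hq1 : q ≤ 1) {E : Finset (Sym2 V)} (hE : IsTTSP E s t)
    (hst : s(s, t) ∉ E) {M : Finset (Sym2 V)} (hM : M ⊆ insert s(s, t) E) {x y z : Sym2 V} (hx : x ∈ M) (hy : y ∈ M) (hz : z ∈ M)
    (hxy : x ≠ y) (hxz : x ≠ z) (hyz : y ≠ z) {g : Finset (Sym2 V) → ℝ}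
    (hgx : ∀ A : Finset (Sym2 V), g (insert x A) = g A) (hgy : ∀ A : Finset (Sym2 V), g (insert y A) = g A)
    (hgz : ∀ A : Finset (Sym2 V), g (insert z A) = g A)
    (hmono : ∀ ⦃A B : Finset (Sym2 V)⦄, A ⊆ B → B ⊆ M → g A ≤ g B) :
    apPsi q M (fun A => if (x ∈ A ∧ y ∈ A) ∨ (x ∈ A ∧ z ∈ A) ∨ (y ∈ A ∧ z ∈ A) then 1 else 0) g ≤ 0 := by
  refine apPsi_level3_sub_nonpos_of_isTTSP hq0 hq1 hE hst hM hx hy hz hxy hxz hyz (fun e he A => ?_) (fun A B hAB _ => ?_)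
    hgx hgy hgz hmono
  · have hex : x ≠ e := fun h => he (h ▸ by simp)
    have hey : y ≠ e := fun h => he (h ▸ by simp)
    have hez : z ≠ e := fun h => he (h ▸ by simp)
    simp only [Finset.mem_insert, hex, hey, hez, false_or]
  · by_cases hB : (x ∈ B ∧ y ∈ B) ∨ (x ∈ B ∧ z ∈ B) ∨ (y ∈ B ∧ z ∈ B)
    · rw [if_pos hB]; split_ifs <;> norm_num
    · have hA : ¬ ((x ∈ A ∧ y ∈ A) ∨ (x ∈ A ∧ z ∈ A) ∨ (y ∈ A ∧ z ∈ A)) := fun h => hB (by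
        rcases h with ⟨h1, h2⟩ | ⟨h1, h2⟩ | ⟨h1, h2⟩
        · exact Or.inl ⟨hAB h1, hAB h2⟩
        · exact Or.inr (Or.inl ⟨hAB h1, hAB h2⟩)
        · exact Or.inr (Or.inr ⟨hAB h1, hAB h2⟩))
      rw [if_neg hA, if_neg hB]

/-- **The threshold `≥ 3 of 4` in every deletion cell** (`0 < q ≤ 1`): `x, y, z, w ∈ M ⊆ E ∪ {st}` distinct, `g` increasing on the subsets
of `M` reading none of them ⟹ `apPsi q M 1{≥ 3 of x,y,z,w} g ≤ 0` (file 34's identity `FK.apPsi_thr3of4_eq` + file 39's U¹¹ and AND on `M`).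
[cite: Grimmett2006, §3.8 Thm. (3.90) (pp. 61–62); §3.9 (pp. 63–64)] [cite: Wagner2006, Thm. 5.8(d), §5.3] -/
theorem apPsi_thr3of4_sub_nonpos_of_isTTSP {q : ℝ} (hq0 : 0 < q) (hq1 : q ≤ 1) {E : Finset (Sym2 V)} (hE : IsTTSP E s t)
    (hst : s(s, t) ∉ E) {M : Finset (Sym2 V)} (hM : M ⊆ insert s(s, t) E) {x y z w : Sym2 V} (hx : x ∈ M) (hy : y ∈ M)
    (hz : z ∈ M) (hw : w ∈ M) (hxy : x ≠ y) (hxz : x ≠ z) (hxw : x ≠ w) (hyz : y ≠ z) (hyw : y ≠ w) (hzw : z ≠ w)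
    {g : Finset (Sym2 V) → ℝ}
    (hgx : ∀ A : Finset (Sym2 V), g (insert x A) = g A) (hgy : ∀ A : Finset (Sym2 V), g (insert y A) = g A)
    (hgz : ∀ A : Finset (Sym2 V), g (insert z A) = g A) (hgw : ∀ A : Finset (Sym2 V), g (insert w A) = g A)
    (hmono : ∀ ⦃A B : Finset (Sym2 V)⦄, A ⊆ B → B ⊆ M → g A ≤ g B) :
    apPsi q M (fun A => if (x ∈ A ∧ y ∈ A ∧ z ∈ A) ∨ (x ∈ A ∧ y ∈ A ∧ w ∈ A) ∨ (x ∈ A ∧ z ∈ A ∧ w ∈ A) ∨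
        (y ∈ A ∧ z ∈ A ∧ w ∈ A) then 1 else 0) g ≤ 0 := by
  rw [apPsi_thr3of4_eq q hx hy hz hw]
  have h1 := apPsi_pivot_split_sub_nonpos_of_isTTSP hq0 hq1 hE hst hM hz hx hy hxz.symm hyz.symm hxy hgz hgx hgy hmono
  have h2 := apPsi_pivot_split_sub_nonpos_of_isTTSP hq0 hq1 hE hst hM hw hx hy hxw.symm hyw.symm hxy hgw hgx hgy hmono
  have h3 := apPsi_pivot_split_sub_nonpos_of_isTTSP hq0 hq1 hE hst hM hx hz hw hxz hxw hzw hgx hgz hgw hmono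
  have h4 := apPsi_pivot_split_sub_nonpos_of_isTTSP hq0 hq1 hE hst hM hy hz hw hyz hyw hzw hgy hgz hgw hmono
  have hS : ({x, y, z, w} : Finset (Sym2 V)) ⊆ M := by
    intro e he
    simp only [Finset.mem_insert, Finset.mem_singleton] at he
    rcases he with rfl | rfl | rfl | rfl <;> assumption
  have h5 := apPsi_andSet_sub_nonpos_of_isTTSP hq0 hq1 hE hst hM hS ⟨x, by simp⟩ (fun e he A => by
    simp only [Finset.mem_insert, Finset.mem_singleton] at he
    rcases he with rfl | rfl | rfl | rfl
    · exact hgx A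
    · exact hgy A
    · exact hgz A
    · exact hgw A) hmono
  have hfun : (fun X : Finset (Sym2 V) => if ({x, y, z, w} : Finset (Sym2 V)) ⊆ X then (1 : ℝ) else 0) =
      fun A => if x ∈ A ∧ y ∈ A ∧ z ∈ A ∧ w ∈ A then (1 : ℝ) else 0 := by
    funext X; simp only [Finset.insert_subset_iff, Finset.singleton_subset_iff]
  rw [hfun] at h5
  linarith

/-- **The threshold `≥ 2 of 4` in every deletion cell** (dual type, `FK.apPsi_thr2of4_eq_thr3of4`). [cite: Grimmett2006, §3.8 Thm. (3.90) (pp. 61–62)] -/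
theorem apPsi_thr2of4_sub_nonpos_of_isTTSP {q : ℝ} (hq0 : 0 < q) (hq1 : q ≤ 1) {E : Finset (Sym2 V)} (hE : IsTTSP E s t)
    (hst : s(s, t) ∉ E) {M : Finset (Sym2 V)} (hM : M ⊆ insert s(s, t) E) {x y z w : Sym2 V} (hx : x ∈ M) (hy : y ∈ M)
    (hz : z ∈ M) (hw : w ∈ M) (hxy : x ≠ y) (hxz : x ≠ z) (hxw : x ≠ w) (hyz : y ≠ z) (hyw : y ≠ w) (hzw : z ≠ w)
    {g : Finset (Sym2 V) → ℝ}
    (hgx : ∀ A : Finset (Sym2 V), g (insert x A) = g A) (hgy : ∀ A : Finset (Sym2 V), g (insert y A) = g A)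
    (hgz : ∀ A : Finset (Sym2 V), g (insert z A) = g A) (hgw : ∀ A : Finset (Sym2 V), g (insert w A) = g A)
    (hmono : ∀ ⦃A B : Finset (Sym2 V)⦄, A ⊆ B → B ⊆ M → g A ≤ g B) :
    apPsi q M (fun A => if (x ∈ A ∧ y ∈ A) ∨ (x ∈ A ∧ z ∈ A) ∨ (x ∈ A ∧ w ∈ A) ∨ (y ∈ A ∧ z ∈ A) ∨
        (y ∈ A ∧ w ∈ A) ∨ (z ∈ A ∧ w ∈ A) then 1 else 0) g ≤ 0 := by
  rw [apPsi_thr2of4_eq_thr3of4 q hx hy hz hw]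
  exact apPsi_thr3of4_sub_nonpos_of_isTTSP hq0 hq1 hE hst hM hx hy hz hw hxy hxz hxw hyz hyw hzw hgx hgy hgz hgw hmono

end FK

end Summit.CriticalPhenomena.PercolationContinuityZ3.Theorems

end
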